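import Literature.Analysis.FluidPDE.AncientMildWeak
import Literature.Analysis.FluidPDE.MildL3Restart
import Literature.Analysis.FluidPDE.LerayHopfProofs
import HarnessLib

-- build-artefact touch (ops-buildfix 2026-08-24): the hub olean of this module was page-truncated by the 2026-08-23T18:18Z
-- disk-full on the build root; a source change forces every checkout to recompile it. No content change.

/-!
# Mild solutions are weak solutions in `L^∞_t L^q_x` (discharge of `IsMildNSSolutionOn.isWeakNSSolutionOn`)

Analysis/FluidPDE support file (theorems only, no definitions, no named facts): the **discharge**
`Literature.Analysis.FluidPDE.IsMildNSSolutionOn.isWeakNSSolutionOn_holds` of the named fact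
`Literature.Analysis.FluidPDE.IsMildNSSolutionOn.isWeakNSSolutionOn` (`MildSolution.lean`;
Fabes–Jones–Rivière 1972, Thm. 2.1, (ii) ⇒ (i); Lemarié-Rieusset 2002, Thm. 11.2 / 2016,
Thm. 6.1): a mild solution on `[0, T)` in the *duality (very weak Duhamel) form* from a datum
(`Literature.Analysis.FluidPDE.IsMildNSSolutionFrom` / `…IsMildNSSolutionOn`: slices weakly
divergence free, and for every `φ ∈ C_c^∞` divergence free
`⟨u(t), φ⟩ = ⟨u₀, e^{νtΔ}φ⟩ + ∫₀ᵗ ⟨u ⊗ u, ∇e^{ν(t-τ)Δ}φ⟩ dτ + ∫₀ᵗ ⟨f, e^{ν(t-τ)Δ}φ⟩ dτ`), in the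
Fabes–Jones–Rivière class `u₀ ∈ L^q`, `u ∈ L^∞((0,T); L^q)` jointly measurable, `q ≥ 2`,
`f ∈ L¹((0,T) × E)`, `0 < ν`, is a weak (Leray-type, pressure-free) solution on `[0, T)` with
datum `u₀` (`Literature.Analysis.FluidPDE.IsWeakNSSolutionOn`). Its `L^∞`, ancient, datum-free
twin in the tree is `Literature.Analysis.FluidPDE.IsBoundedAncientMildSolution.isBoundedWeakNSSolutionOn`
(`AncientMildWeak.lean`), whose architecture this file follows.

## Proof (the printed one: test the duality identity with `∂ₜψ + νΔψ` and integrate in time)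

Let `ψ` be a space–time test field on the slab `(-∞, T) × E` with divergence-free slices; its
time support lies in `[a', b']` with `b' < T` (`IsSpaceTimeTestOn.exists_time_support_lt`). Put
`Λ = ∂ₜψ + νΔψ`, a space–time test field with divergence-free slices
(`IsSpaceTimeTestOn.heatAdjointField_top`, `isDivFree_heatAdjointField`). For `t ∈ (0, T)` the
duality identity tested with `Λ(t)` reads
`⟨u(t), Λ(t)⟩ = ⟨u₀, e^{νtΔ}Λ(t)⟩ + ∫₀ᵗ ⟨u(τ), (u(τ)·∇) e^{ν(t-τ)Δ}Λ(t)⟩ dτ + ∫₀ᵗ ⟨f(τ), e^{ν(t-τ)Δ}Λ(t)⟩ dτ`.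
Integrate over `t ∈ (0, T)`; with the backward caloric Duhamel integral
`𝒰[Λ](τ) = ∫_{σ>0} e^{νσΔ}Λ(τ + σ) dσ` (`Literature.Analysis.FluidPDE.heatDuhamelBack`) and its
backward heat equation `𝒰[∂ₜψ + νΔψ] = -ψ` (`IsSpaceTimeTestOn.heatDuhamelBack_heatAdjointField`):
* the datum term gives `∫₀ᵀ ⟨u₀, e^{νtΔ}Λ(t)⟩ dt = ⟨u₀, 𝒰[Λ](0)⟩ = -⟨u₀, ψ(0)⟩` (Hölder
  `L^q × L^{q'}` in `x` with the `L^{q'}` contraction of `e^{νtΔ}`, Fubini on `(0,T] × E`);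
* the nonlinear term, after Fubini on `(0,T) × ((0,T) × E)` for the transport integrand
  `⟪u, K_t u⟫`, `K_t(τ, x) = 1_{τ<t} D(e^{ν(t-τ)Δ}Λ(t))(x)`, dominated slicewise in time by the
  trilinear Hölder bound `‖K_t(τ)‖_p ‖u(τ)‖_q²` (`2/q + 1/p = 1`), and
  `∫ K_t(τ, x) dt = D𝒰[Λ](τ)(x) = -Dψ(τ)(x)`, gives `-∫∫ ⟨u, (u·∇)ψ⟩`;
* the force term, after the same Fubini with the integrand dominated by `‖Λ‖_∞ ‖f‖`, and
  `∫ 1_{τ<t} e^{ν(t-τ)Δ}Λ(t)(x) dt = 𝒰[Λ](τ)(x) = -ψ(τ)(x)`, gives `-∫∫ ⟨f, ψ⟩`;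
* the left side is `∫∫ ⟪u, ∂ₜψ⟫ + ν⟪u, Δψ⟫`.
Summing gives the weak identity. Local square integrability of the class
(`∫_{(0,T) × K} ‖u‖² < ∞`, compact `K`) is Hölder `L^q(K) ⊂ L²(K)` slicewise (`q ≥ 2`) and Tonelli;
weak divergence-freeness holds at every `t ∈ [0, T)`. Every Fubini exchange is absolutely
convergent; joint measurability of `u` rules out junk Bochner integrals.

## Contents (all proved; the `[folklore]` plumbing lemmas are file-private)

* `IsSpaceTimeTestOn.exists_eLpNorm_slice_le` — slices of a space–time test field are bounded in
  every `L^p` uniformly in time.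
* `integral_Ioc_integral_inner_heatTest_eq_inner_heatDuhamelBack`,
  `integral_Ioc_integral_inner_heatTest_heatAdjointField_eq_neg` — **the datum term** for
  `w ∈ L^q`, `1 ≤ q ≤ ∞`.
* `IsSpaceTimeTestOn.continuousOn_heatTest_param / aestronglyMeasurable_caloricKernel(_slice) /
  norm_caloricKernel_le / integrableOn_caloricKernel_time / setIntegral_caloricKernel_eq_heatDuhamelBack`
  — the scalar caloric kernel `1_{τ<t} e^{ν(t-τ)Δ}Λ(t)(x)` (twins of the tree's transport-kernel
  lemmas of `KatoUniquenessDual.lean`, without the derivative).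
* `MemLqLp.integrable_prod_inner_test / integrable_prod_inner_convect_test`,
  `integrable_prod_inner_force_test` — slab integrability of `⟪u, Θ⟫`, `⟪u, DΘ u⟫`, `⟪f, Θ⟫` for
  `u ∈ L^∞(S; L^q)` jointly measurable, `f ∈ L¹`.
* `MemLqLp.integral_Ioo_intervalIntegral_integral_inner_convect_heatTest_eq` — **the nonlinear
  term** (with integrability in `t`).
* `integral_Ioo_intervalIntegral_integral_inner_force_heatTest_eq` — **the force term** (with
  integrability in `t`).
* `MemLqLp.lintegral_enorm_sq_prod_lt_top_of_two_le` — **local square integrability** of the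
  class `L^∞((0,T); L^q)`, `q ≥ 2`.
* `IsMildNSSolutionOn.isWeakNSSolutionOn_holds` — **the discharge**.

## Mathlib / tree search

Used from the tree: the space–time test-field calculus and the backward Duhamel integral
(`HeatDuhamelBack`: `exists_norm_le`, `exists_time_support`, `continuousOn_duhamelIntegrand`,
`heatDuhamelBack_eq_setIntegral_Ioc`, `norm_heatDuhamelBack_le`, `continuous_heatDuhamelBack`),
`ClassicalSolutionCalculus` (`exists_compact_slice_subset`, `hasCompactSupport_slice`),
`AncientMildWeak` (`exists_time_support_lt`, `heatAdjointField_top`, `isDivFree_heatAdjointField`,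
`heatAdjointField_eq_zero_of_time_support`, `heatDuhamelBack_heatAdjointField`),
`KatoUniquenessDual` (`continuousOn_heatExtension_param`, `aestronglyMeasurable_transportKernel(_slice)`,
`integrableOn_transportKernel_time`, `setIntegral_transportKernel_eq_fderiv_heatDuhamelBack`,
`isTestFunctionOn_slice`, `volume_restrict_prod_univ_eq_prod`), `KatoUniquenessPairing`
(`memLp_fderiv_heatTest`, `eLpNorm_fderiv_heatTest_le`), the heat-flow facts
`memLp_heatFlow_holds` / `eLpNorm_heatFlow_le_holds` (`MildSolutionHeatFlowProofs`),
`norm_heatFlow_le` (`MildSolutionProofs`), `integrable_inner_of_memLp_conj` (`MildL3Restart`),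
`MemLqLp.ae_eLpNorm_le_top` (`LerayHopfProofs`). From Mathlib: `integrable_prod_iff`,
`integral_integral_swap`, `integral_prod`, `Integrable.integral_prod_left / integral_prod_right /
prod_right_ae`, `integral_inner`, `ContinuousLinearMap.integral_apply`,
`eLpNorm_le_eLpNorm_mul_eLpNorm_of_nnnorm`, `eLpNorm_le_eLpNorm_mul_rpow_measure_univ`,
`lintegral_prod`, `Measure.prod_restrict`, `ENNReal.HolderConjugate.conjExponent`. Mathlib (this
pin) has no heat semigroup on functions and no Navier–Stokes notions.

## References

* E. B. Fabes, B. F. Jones, N. M. Rivière, *The initial value problem for the Navier–Stokes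
  equations with data in `L^p`*, Arch. Rational Mech. Anal. 45 (1972) 222–240, Thm. 2.1 and its
  proof ((ii) ⇒ (i)). [FabesJonesRiviere1972]
* P. G. Lemarié-Rieusset, *The Navier–Stokes Problem in the 21st Century*, CRC Press 2016,
  Prop. 4.3 (B)–(C) p. 74 (Duhamel integrals), Thm. 6.1, proof of Thm. 7.7 (fourth step, p. 149).
  [LemarieRieusset2016]
* P. G. Lemarié-Rieusset, *Recent developments in the Navier–Stokes problem*, Chapman & Hall/CRC
  2002, Thm. 11.2. [LemarieRieusset2002]
* L. C. Evans, *Partial Differential Equations*, 2nd ed., AMS 2010, §2.3.1 (heat kernel,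
  `‖K_t‖₁ = 1`). [Evans2010]
-/

noncomputable section

open MeasureTheory TopologicalSpace Set Function Filter Topology InnerProductSpace
open scoped RealInnerProductSpace ENNReal NNReal Laplacian

namespace Literature.Analysis.FluidPDE

variable {E : Type*} [NormedAddCommGroup E] [InnerProductSpace ℝ E] [FiniteDimensional ℝ E]
  [MeasurableSpace E] [BorelSpace E]

/-! ### Uniform `L^p` bounds of the slices of a space–time test field -/

section SliceBounds

variable {F : Type*} [NormedAddCommGroup F] [NormedSpace ℝ F]

/-- **The slices of a space–time test field are bounded in `L^p` uniformly in time**: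
`‖Θ(t)‖_{L^p} ≤ R < ∞` for all `t` and every `p ∈ [0, ∞]` (they are bounded by `‖Θ‖_∞` and
supported in the fixed compact `x`-shadow of the support of `Θ`). [folklore] -/
private theorem IsSpaceTimeTestOn.exists_eLpNorm_slice_le {Θ : ℝ → E → F}
    (hΘ : IsSpaceTimeTestOn (⊤ : Opens (ℝ × E)) Θ) (p : ℝ≥0∞) :
    ∃ R : ℝ≥0∞, R < ⊤ ∧ ∀ t, eLpNorm (Θ t) p (volume : Measure E) ≤ R := by
  obtain ⟨M, hM0, hM⟩ := hΘ.exists_norm_le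
  obtain ⟨K, hK, hKt⟩ := hΘ.exists_compact_slice_subset
  refine ⟨eLpNorm (K.indicator fun _ => (M : ℝ)) p (volume : Measure E), ?_, fun t => ?_⟩
  · exact (memLp_indicator_const p hK.measurableSet (M : ℝ)
      (Or.inr hK.measure_lt_top.ne)).eLpNorm_lt_top
  · refine eLpNorm_mono fun y => ?_
    by_cases hy : y ∈ K
    · rw [indicator_of_mem hy, Real.norm_of_nonneg hM0]
      exact hM t y
    · have h0 : Θ t y = 0 := by
        by_contra h
        exact hy (hKt t (subset_tsupport _ (mem_support.2 h)))
      rw [h0, norm_zero]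
      exact norm_nonneg _

end SliceBounds

/-! ### Hölder pairing -/

section Holder

/-- Hölder bound of the pairing of an `L^q` field with an `L^{q'}` field, conjugate exponents
(`1 ≤ q ≤ ∞`). [folklore] -/
private theorem integral_abs_inner_le_of_memLp_conj' {w h : E → E}
    {q q' : ℝ≥0∞} [hqq' : q.HolderConjugate q']
    (hw : MemLp w q volume) (hh : MemLp h q' volume) :
    ∫ x, |⟪w x, h x⟫| ≤ (eLpNorm w q volume * eLpNorm h q' volume).toReal := by
  have hint : Integrable (fun x => ⟪w x, h x⟫) volume := integrable_inner_of_memLp_conj hw hh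
  have h1 : eLpNorm (fun x => ⟪w x, h x⟫) 1 volume ≤ eLpNorm w q volume * eLpNorm h q' volume := by
    have h := eLpNorm_le_eLpNorm_mul_eLpNorm_of_nnnorm hw.1 hh.1 (fun a b => ⟪a, b⟫) 1
      (Eventually.of_forall fun x => by
        simpa only [one_mul] using nnnorm_inner_le_nnnorm (𝕜 := ℝ) (w x) (h x)) (hpqr := hqq')
    simpa only [ENNReal.coe_one, one_mul] using h
  have h2 : ∫ x, |⟪w x, h x⟫| = (eLpNorm (fun x => ⟪w x, h x⟫) 1 volume).toReal := by
    rw [eLpNorm_one_eq_lintegral_enorm, ← integral_norm_eq_lintegral_enorm hint.1]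
    rfl
  rw [h2]
  exact ENNReal.toReal_mono (ENNReal.mul_ne_top hw.2.ne hh.2.ne) h1

end Holder

/-! ### The datum term -/

section Datum

variable {ν : ℝ}

/-- **The datum term of the duality identity, integrated in time.** For `w ∈ L^q`
(`1 ≤ q ≤ ∞`; Hölder with the conjugate exponent `q'`), `0 < ν`, a space–time test field `Λ` with
time support in
`[a', b']`, and `0 ≤ b`, `b' ≤ b`:
`∫_{(0,b]} ∫ ⟪w(x), (e^{νtΔ}Λ(t))(x)⟫ dx dt = ∫ ⟪w(x), 𝒰[Λ](0)(x)⟫ dx`,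
`𝒰[Λ](0) = ∫_{σ>0} e^{νσΔ}Λ(σ) dσ` the backward caloric Duhamel integral at time `0` (Hölder in `x`
with `‖e^{νtΔ}Λ(t)‖_{q'} ≤ sup_t ‖Λ(t)‖_{q'}`, Fubini on `(0,b] × E`, and the time integral moved
inside the pairing; Lemarié-Rieusset 2016, Prop. 4.3 (B)–(C) and proof of Thm. 7.7, fourth step;
Fabes–Jones–Rivière 1972, proof of Thm. 2.1). [cite: LemarieRieusset2016, Prop. 4.3 (B), (C), p. 74] -/
theorem integral_Ioc_integral_inner_heatTest_eq_inner_heatDuhamelBack (hν : 0 < ν)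
    {w : E → E} {q : ℝ≥0∞} (hq : 1 ≤ q) (hw : MemLp w q volume)
    {Λ : ℝ → E → E} (hΛ : IsSpaceTimeTestOn (⊤ : Opens (ℝ × E)) Λ)
    {a' b' b : ℝ} (hsupp : ∀ t, t ∉ Icc a' b' → Λ t = 0) (hb : 0 ≤ b) (hb'b : b' ≤ b) :
    ∫ t in Ioc 0 b, ∫ x, ⟪w x, heatTest ν (Λ t) t x⟫ = ∫ x, ⟪w x, heatDuhamelBack ν Λ 0 x⟫ := by
  -- the conjugate exponent `q'` of `q`
  set q' : ℝ≥0∞ := ENNReal.conjExponent q with hq'_def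
  haveI hqq' : q.HolderConjugate q' := .conjExponent hq
  have hq'1 : 1 ≤ q' := ENNReal.HolderConjugate.one_le q' q
  obtain ⟨C, -, hC⟩ := hΛ.exists_norm_le
  obtain ⟨R, hR, hRt⟩ := hΛ.exists_eLpNorm_slice_le q'
  -- the caloric family `G(t, x) = (e^{νtΔ} Λ(t))(x)` written with the caloric extension
  set G : ℝ × E → E := fun p => UnboundedOperators.heatExtension (Λ p.1) (ν * p.1) p.2 with hG_def
  have hH : ∀ t, 0 < t → ∀ x, heatTest ν (Λ t) t x = G (t, x) := by
    intro t ht x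
    simp only [hG_def]
    rw [heatTest_of_pos hν ht]
  have hcont : ContinuousOn G {p : ℝ × E | 0 < p.1} := by
    have hc2 : Continuous fun p : ℝ × E => (((0 : ℝ), p.1, p.2) : ℝ × ℝ × E) := by fun_prop
    have h := ContinuousOn.comp (g := fun p : ℝ × ℝ × E =>
        UnboundedOperators.heatExtension (Λ (p.1 + p.2.1)) (ν * p.2.1) p.2.2)
      (f := fun p : ℝ × E => (((0 : ℝ), p.1, p.2) : ℝ × ℝ × E)) (s := {p : ℝ × E | 0 < p.1})
      (hΛ.continuousOn_duhamelIntegrand hν) hc2.continuousOn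
      (fun p hp => show (0 : ℝ) < p.1 from hp)
    simpa only [Function.comp_def, zero_add] using h
  -- `L^{q'}` slices of `G`, uniformly bounded by `R`
  have hGq : ∀ t, 0 < t →
      MemLp (fun x => G (t, x)) q' volume ∧ eLpNorm (fun x => G (t, x)) q' volume ≤ R := by
    intro t ht
    have hΛq : MemLp (Λ t) q' volume :=
      (hΛ.contDiff_slice t).continuous.memLp_of_hasCompactSupport (hΛ.hasCompactSupport_slice t)
    have hpos : 0 < ν * t := mul_pos hν ht
    have hflow : heatFlow (Λ t) (ν * t) = fun x => G (t, x) := by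
      rw [heatFlow_of_pos _ hpos]
    refine ⟨?_, ?_⟩
    · have h := memLp_heatFlow_holds hΛq hq'1 hpos.le
      rwa [hflow] at h
    · have h := eLpNorm_heatFlow_le_holds hΛq hq'1 hpos.le
      rw [hflow] at h
      exact h.trans (hRt t)
  -- the pairing `F(t, x) = ⟪w x, G(t, x)⟫` is integrable on the slab `(0, b] × E`
  set μ : Measure ℝ := volume.restrict (Ioc 0 b) with hμ
  haveI : IsFiniteMeasure μ := by rw [hμ]; exact isFiniteMeasure_restrict.2 measure_Ioc_lt_top.ne
  have hGm : AEStronglyMeasurable G (μ.prod (volume : Measure E)) := by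
    have hS : MeasurableSet {p : ℝ × E | 0 < p.1} := measurableSet_lt measurable_const measurable_fst
    have h1 : AEStronglyMeasurable G ((volume : Measure (ℝ × E)).restrict {p : ℝ × E | 0 < p.1}) :=
      hcont.aestronglyMeasurable hS
    rw [hμ, ← volume_restrict_prod_univ_eq_prod]
    refine h1.mono_measure (Measure.restrict_mono (fun p hp => ?_) le_rfl)
    exact (mem_prod.1 hp).1.1
  have hFm : AEStronglyMeasurable (fun p : ℝ × E => ⟪w p.2, G p⟫) (μ.prod (volume : Measure E)) :=
    (hw.1.comp_snd).inner hGm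
  have hF : Integrable (fun p : ℝ × E => ⟪w p.2, G p⟫) (μ.prod (volume : Measure E)) := by
    rw [integrable_prod_iff hFm]
    constructor
    · rw [hμ]
      refine (ae_restrict_iff' measurableSet_Ioc).2 (Eventually.of_forall fun t ht => ?_)
      exact integrable_inner_of_memLp_conj hw (hGq t ht.1).1
    · refine Integrable.mono' (integrable_const ((eLpNorm w q volume).toReal * R.toReal))
        hFm.norm.integral_prod_right' ?_
      rw [hμ]
      refine (ae_restrict_iff' measurableSet_Ioc).2 (Eventually.of_forall fun t ht => ?_)
      rw [Real.norm_of_nonneg (integral_nonneg fun _ => norm_nonneg _)]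
      obtain ⟨hGt, hle⟩ := hGq t ht.1
      calc ∫ x, ‖⟪w x, G (t, x)⟫‖ = ∫ x, |⟪w x, G (t, x)⟫| := by simp only [Real.norm_eq_abs]
        _ ≤ (eLpNorm w q volume * eLpNorm (fun x => G (t, x)) q' volume).toReal :=
            integral_abs_inner_le_of_memLp_conj' hw hGt
        _ ≤ (eLpNorm w q volume).toReal * R.toReal := by
            rw [ENNReal.toReal_mul]
            exact mul_le_mul_of_nonneg_left (ENNReal.toReal_mono hR.ne hle) ENNReal.toReal_nonneg
  -- replace `heatTest` by `G` and swap the integrals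
  have e1 : ∫ t in Ioc 0 b, ∫ x, ⟪w x, heatTest ν (Λ t) t x⟫ = ∫ t in Ioc 0 b, ∫ x, ⟪w x, G (t, x)⟫ := by
    refine setIntegral_congr_fun measurableSet_Ioc fun t ht => ?_
    refine integral_congr_ae (Eventually.of_forall fun x => ?_)
    show ⟪w x, heatTest ν (Λ t) t x⟫ = ⟪w x, G (t, x)⟫
    rw [hH t ht.1 x]
  rw [e1]
  have hF' : Integrable (uncurry fun (t : ℝ) (x : E) => ⟪w x, G (t, x)⟫) (μ.prod (volume : Measure E)) := hF
  rw [integral_integral_swap hF']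
  -- the time integral of `G(·, x)` is `𝒰[Λ](0)(x)`
  have hGt : ∀ x, IntegrableOn (fun t => G (t, x)) (Ioc 0 b) volume ∧
      ∫ t in Ioc 0 b, G (t, x) = heatDuhamelBack ν Λ 0 x := by
    intro x
    have hct : ContinuousOn (fun t => G (t, x)) (Ioi 0) := by
      have hc2 : Continuous fun t : ℝ => ((t, x) : ℝ × E) := by fun_prop
      have h := ContinuousOn.comp (s := Ioi 0) hcont hc2.continuousOn
        (fun t (ht : t ∈ Ioi 0) => show ((t, x) : ℝ × E) ∈ {p : ℝ × E | 0 < p.1} from ht)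
      simpa only [Function.comp_def] using h
    have hmt : AEStronglyMeasurable (fun t => G (t, x)) (volume.restrict (Ioc 0 b)) :=
      (hct.aestronglyMeasurable measurableSet_Ioi).mono_measure
        (Measure.restrict_mono Ioc_subset_Ioi_self le_rfl)
    have hint : IntegrableOn (fun t => G (t, x)) (Ioc 0 b) volume := by
      refine Integrable.mono' (integrable_const C) hmt ?_
      refine (ae_restrict_iff' measurableSet_Ioc).2 (Eventually.of_forall fun t ht => ?_)
      exact UnboundedOperators.norm_heatExtension_le (hC _) (mul_pos hν ht.1) x
    refine ⟨hint, ?_⟩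
    rw [hΛ.heatDuhamelBack_eq_setIntegral_Ioc hν hsupp (s := 0) (L := b) hb (by linarith) x]
    refine setIntegral_congr_fun measurableSet_Ioc fun σ _ => ?_
    simp only [hG_def, zero_add]
  have e3 : ∀ x, ∫ t in Ioc 0 b, ⟪w x, G (t, x)⟫ = ⟪w x, heatDuhamelBack ν Λ 0 x⟫ := fun x => by
    obtain ⟨hint, hval⟩ := hGt x
    rw [integral_inner hint, hval]
  simp_rw [hμ]
  exact integral_congr_ae (Eventually.of_forall e3)

/-- **The datum term of the weak formulation.** With `Λ = ∂ₜψ + νΔψ` for a space–time test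
field `ψ` with time support in `[a', b']`, `b' ≤ b`, `0 ≤ b`, and `w ∈ L^q` (`1 ≤ q ≤ ∞`):
`∫_{(0,b]} ∫ ⟪w, e^{νtΔ}(∂ₜψ + νΔψ)(t)⟫ dx dt = -∫ ⟪w, ψ(0)⟫ dx`
(the previous lemma and the backward heat equation `𝒰[∂ₜψ + νΔψ] = -ψ`; Fabes–Jones–Rivière 1972,
proof of Thm. 2.1, the term producing the initial datum; Lemarié-Rieusset 2016, proof of
Thm. 7.7, fourth step). [cite: FabesJonesRiviere1972, Thm. 2.1] -/
theorem integral_Ioc_integral_inner_heatTest_heatAdjointField_eq_neg (hν : 0 < ν)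
    {w : E → E} {q : ℝ≥0∞} (hq : 1 ≤ q) (hw : MemLp w q volume)
    {ψ : ℝ → E → E} (hψ : IsSpaceTimeTestOn (⊤ : Opens (ℝ × E)) ψ)
    {a' b' b : ℝ} (hsupp : ∀ t, t ∉ Icc a' b' → ψ t = 0) (hb : 0 ≤ b) (hb'b : b' ≤ b) :
    ∫ t in Ioc 0 b, ∫ x, ⟪w x, heatTest ν (fun y => timeDeriv ψ t y + ν • Δ (ψ t) y) t x⟫ =
      -∫ x, ⟪w x, ψ 0 x⟫ := by
  have hΛ : IsSpaceTimeTestOn (⊤ : Opens (ℝ × E)) (fun t y => timeDeriv ψ t y + ν • Δ (ψ t) y) :=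
    hψ.heatAdjointField_top ν
  have hΛsupp : ∀ t, t ∉ Icc a' b' → (fun t y => timeDeriv ψ t y + ν • Δ (ψ t) y) t = 0 :=
    fun t ht => heatAdjointField_eq_zero_of_time_support hsupp ν ht
  have h := integral_Ioc_integral_inner_heatTest_eq_inner_heatDuhamelBack hν hq hw hΛ hΛsupp hb hb'b
  calc ∫ t in Ioc 0 b, ∫ x, ⟪w x, heatTest ν (fun y => timeDeriv ψ t y + ν • Δ (ψ t) y) t x⟫
      = ∫ x, ⟪w x, heatDuhamelBack ν (fun t y => timeDeriv ψ t y + ν • Δ (ψ t) y) 0 x⟫ := h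
    _ = -∫ x, ⟪w x, ψ 0 x⟫ := by
        rw [← integral_neg]
        refine integral_congr_ae (Eventually.of_forall fun x => ?_)
        show ⟪w x, heatDuhamelBack ν (fun t y => timeDeriv ψ t y + ν • Δ (ψ t) y) 0 x⟫ = -⟪w x, ψ 0 x⟫
        rw [hψ.heatDuhamelBack_heatAdjointField hν 0 x, inner_neg_right]

end Datum


/-! ### The caloric kernel of a space–time test field: continuity, measurability, time integral -/

section CaloricKernel

variable {ν : ℝ} {Θ : ℝ → E → E}

/-- **Joint continuity of the caloric kernel** `(t, τ, x) ↦ (e^{ν(t-τ)Δ}Θ(t))(x)` on `{τ < t}` for a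
space–time test field `Θ` (`continuousOn_heatExtension_param`; scalar twin of the tree's
`IsSpaceTimeTestOn.continuousOn_fderiv_heatTest_param`). [folklore] -/
private theorem IsSpaceTimeTestOn.continuousOn_heatTest_param
    (hΘ : IsSpaceTimeTestOn (⊤ : Opens (ℝ × E)) Θ) (hν : 0 < ν) :
    ContinuousOn (fun q : ℝ × ℝ × E => heatTest ν (Θ q.1) (q.1 - q.2.1) q.2.2) {q | q.2.1 < q.1} := by
  obtain ⟨M, -, hM⟩ := hΘ.exists_norm_le
  have hcont := continuousOn_heatExtension_param (P := ℝ) hΘ.continuous_uncurry hM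
  have hc2 : Continuous fun q : ℝ × ℝ × E => ((q.1, ν * (q.1 - q.2.1), q.2.2) : ℝ × ℝ × E) := by
    fun_prop
  have h := ContinuousOn.comp (g := fun q : ℝ × ℝ × E => UnboundedOperators.heatExtension (Θ q.1) q.2.1 q.2.2)
    (f := fun q : ℝ × ℝ × E => ((q.1, ν * (q.1 - q.2.1), q.2.2) : ℝ × ℝ × E))
    (s := {q | q.2.1 < q.1}) hcont hc2.continuousOn
    (fun q hq => ⟨mem_univ _, mul_pos hν (sub_pos.2 hq), mem_univ _⟩)
  refine h.congr fun q hq => ?_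
  simp only [Function.comp_def]
  exact congrFun (heatTest_of_pos hν (sub_pos.2 hq) (Θ q.1)) q.2.2

/-- **Measurability of the caloric kernel** `(t, τ, x) ↦ 1_{τ<t} (e^{ν(t-τ)Δ}Θ(t))(x)` with respect
to any measure on `ℝ × ℝ × E` (continuous on the measurable set `{τ < t}`). [folklore] -/
private theorem IsSpaceTimeTestOn.aestronglyMeasurable_caloricKernel
    (hΘ : IsSpaceTimeTestOn (⊤ : Opens (ℝ × E)) Θ) (hν : 0 < ν) (μ : Measure (ℝ × ℝ × E)) :
    AEStronglyMeasurable (fun q : ℝ × ℝ × E =>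
      if q.2.1 < q.1 then heatTest ν (Θ q.1) (q.1 - q.2.1) q.2.2 else 0) μ := by
  have hS : MeasurableSet {q : ℝ × ℝ × E | q.2.1 < q.1} :=
    measurableSet_lt measurable_snd.fst measurable_fst
  have heq : (fun q : ℝ × ℝ × E =>
      if q.2.1 < q.1 then heatTest ν (Θ q.1) (q.1 - q.2.1) q.2.2 else 0) =
      {q : ℝ × ℝ × E | q.2.1 < q.1}.indicator (fun q => heatTest ν (Θ q.1) (q.1 - q.2.1) q.2.2) := by
    funext q
    by_cases h : q.2.1 < q.1 <;> simp [h]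
  rw [heq, aestronglyMeasurable_indicator_iff hS]
  exact (hΘ.continuousOn_heatTest_param hν).aestronglyMeasurable hS

/-- **Measurability of a time slice of the caloric kernel** `(τ, x) ↦ 1_{τ<t} (e^{ν(t-τ)Δ}Θ(t))(x)`
for fixed `t`, with respect to any measure on `ℝ × E`. [folklore] -/
private theorem IsSpaceTimeTestOn.aestronglyMeasurable_caloricKernel_slice
    (hΘ : IsSpaceTimeTestOn (⊤ : Opens (ℝ × E)) Θ) (hν : 0 < ν) (t : ℝ) (ρ : Measure (ℝ × E)) :
    AEStronglyMeasurable (fun y : ℝ × E =>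
      if y.1 < t then heatTest ν (Θ t) (t - y.1) y.2 else 0) ρ := by
  have hS : MeasurableSet {y : ℝ × E | y.1 < t} := measurableSet_lt measurable_fst measurable_const
  have heq : (fun y : ℝ × E => if y.1 < t then heatTest ν (Θ t) (t - y.1) y.2 else 0) =
      {y : ℝ × E | y.1 < t}.indicator (fun y => heatTest ν (Θ t) (t - y.1) y.2) := by
    funext y
    by_cases h : y.1 < t <;> simp [h]
  rw [heq, aestronglyMeasurable_indicator_iff hS]
  have hc2 : Continuous fun y : ℝ × E => ((t, y) : ℝ × ℝ × E) := by fun_prop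
  have h := ContinuousOn.comp (g := fun q : ℝ × ℝ × E => heatTest ν (Θ q.1) (q.1 - q.2.1) q.2.2)
    (f := fun y : ℝ × E => ((t, y) : ℝ × ℝ × E)) (s := {y : ℝ × E | y.1 < t})
    (hΘ.continuousOn_heatTest_param hν) hc2.continuousOn (fun y hy => hy)
  exact (show ContinuousOn (fun y : ℝ × E => heatTest ν (Θ t) (t - y.1) y.2)
    {y : ℝ × E | y.1 < t} by simpa only [Function.comp_def] using h).aestronglyMeasurable hS

/-- Pointwise bound of the caloric kernel by `‖Θ‖_∞` (maximum principle). [folklore] -/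
private theorem IsSpaceTimeTestOn.norm_caloricKernel_le
    (hΘ : IsSpaceTimeTestOn (⊤ : Opens (ℝ × E)) Θ) {M : ℝ} (hM0 : 0 ≤ M)
    (hM : ∀ t y, ‖Θ t y‖ ≤ M) (t τ : ℝ) (x : E) :
    ‖(if τ < t then heatTest ν (Θ t) (t - τ) x else 0)‖ ≤ M := by
  have _ := hΘ
  split_ifs with h
  · exact norm_heatFlow_le (hM t) _ x
  · rw [norm_zero]
    exact hM0

/-- **Integrability in `t` of the caloric kernel** on a bounded time interval, for fixed `(τ, x)`
(bounded by `‖Θ‖_∞`, continuous on `t > τ`). [folklore] -/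
private theorem IsSpaceTimeTestOn.integrableOn_caloricKernel_time
    (hΘ : IsSpaceTimeTestOn (⊤ : Opens (ℝ × E)) Θ) (hν : 0 < ν) (τ₀ τ₁ τ : ℝ) (x : E) :
    IntegrableOn (fun t => if τ < t then heatTest ν (Θ t) (t - τ) x else 0) (Ioc τ₀ τ₁) volume := by
  obtain ⟨M, hM0, hM⟩ := hΘ.exists_norm_le
  have hS : MeasurableSet {t : ℝ | τ < t} := measurableSet_lt measurable_const measurable_id
  have heq : (fun t => if τ < t then heatTest ν (Θ t) (t - τ) x else 0) =
      {t : ℝ | τ < t}.indicator (fun t => heatTest ν (Θ t) (t - τ) x) := by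
    funext t
    by_cases h : τ < t <;> simp [h]
  have hmeas : AEStronglyMeasurable (fun t => if τ < t then heatTest ν (Θ t) (t - τ) x else 0)
      (volume.restrict (Ioc τ₀ τ₁)) := by
    rw [heq, aestronglyMeasurable_indicator_iff hS, Measure.restrict_restrict hS]
    have hc2 : Continuous fun t : ℝ => ((t, τ, x) : ℝ × ℝ × E) := by fun_prop
    have h := ContinuousOn.comp (g := fun q : ℝ × ℝ × E => heatTest ν (Θ q.1) (q.1 - q.2.1) q.2.2)
      (f := fun t : ℝ => ((t, τ, x) : ℝ × ℝ × E)) (s := {t : ℝ | τ < t})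
      (hΘ.continuousOn_heatTest_param hν) hc2.continuousOn (fun t ht => ht)
    have h' : ContinuousOn (fun t => heatTest ν (Θ t) (t - τ) x) {t : ℝ | τ < t} := by
      simpa only [Function.comp_def] using h
    exact (h'.aestronglyMeasurable hS).mono_measure (Measure.restrict_mono inter_subset_left le_rfl)
  haveI : IsFiniteMeasure (volume.restrict (Ioc τ₀ τ₁)) :=
    isFiniteMeasure_restrict.2 measure_Ioc_lt_top.ne
  refine Integrable.mono' (integrable_const M) hmeas (Eventually.of_forall fun t => ?_)
  exact hΘ.norm_caloricKernel_le hM0 hM t τ x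

/-- **Time integral of the caloric kernel = the backward Duhamel integral**: for a space–time test
field `Θ` with time support in `[a, b]`, `b ≤ τ₁`, and `τ ∈ [τ₀, τ₁]`,
`∫_{t ∈ (τ₀, τ₁]} 1_{τ<t} (e^{ν(t-τ)Δ}Θ(t))(x) dt = 𝒰[Θ](τ)(x)` (substitution `t = τ + σ`;
Lemarié-Rieusset 2016, Prop. 4.3 (B)–(C)). [cite: LemarieRieusset2016, Prop. 4.3 (B), (C), p. 74] -/
theorem IsSpaceTimeTestOn.setIntegral_caloricKernel_eq_heatDuhamelBack
    (hΘ : IsSpaceTimeTestOn (⊤ : Opens (ℝ × E)) Θ) (hν : 0 < ν) {a b τ₀ τ₁ : ℝ}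
    (hab : ∀ t, t ∉ Icc a b → Θ t = 0) (hb : b ≤ τ₁) {τ : ℝ} (hτ : τ ∈ Icc τ₀ τ₁) (x : E) :
    ∫ t in Ioc τ₀ τ₁, (if τ < t then heatTest ν (Θ t) (t - τ) x else 0) = heatDuhamelBack ν Θ τ x := by
  have heq : (fun t => if τ < t then heatTest ν (Θ t) (t - τ) x else 0) =
      (Ioi τ).indicator (fun t => heatTest ν (Θ t) (t - τ) x) := by
    funext t
    by_cases h : τ < t <;> simp [h]
  rw [heq, setIntegral_indicator measurableSet_Ioi]
  have hset : Ioc τ₀ τ₁ ∩ Ioi τ = Ioc τ τ₁ := by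
    ext t
    simp only [mem_inter_iff, mem_Ioc, mem_Ioi]
    constructor
    · rintro ⟨⟨-, h2⟩, h3⟩; exact ⟨h3, h2⟩
    · rintro ⟨h1, h2⟩; exact ⟨⟨hτ.1.trans_lt h1, h2⟩, h1⟩
  rw [hset]
  have hcongr : ∀ t ∈ Ioc τ τ₁, heatTest ν (Θ t) (t - τ) x =
      UnboundedOperators.heatExtension (Θ ((t - τ) + τ)) (ν * (t - τ)) x := fun t ht => by
    rw [sub_add_cancel]
    exact congrFun (heatTest_of_pos hν (sub_pos.2 ht.1) (Θ t)) x
  rw [setIntegral_congr_fun measurableSet_Ioc hcongr, ← intervalIntegral.integral_of_le hτ.2,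
    intervalIntegral.integral_comp_sub_right
      (fun σ => UnboundedOperators.heatExtension (Θ (σ + τ)) (ν * σ) x) τ,
    sub_self, intervalIntegral.integral_of_le (sub_nonneg.2 hτ.2),
    hΘ.heatDuhamelBack_eq_setIntegral_Ioc hν hab (sub_nonneg.2 hτ.2) (by linarith) x]
  refine setIntegral_congr_fun measurableSet_Ioc fun σ _ => ?_
  rw [add_comm σ τ]

end CaloricKernel




/-! ### Trilinear Hölder bound -/

section Trilinear

/-- `1/q + 1/q = 1/(q/2)` in `ℝ≥0∞`: the Hölder triple behind `‖|a| |b|‖_{q/2} ≤ ‖a‖_q ‖b‖_q`.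
[folklore] -/
private theorem holderTriple_self_half' (q : ℝ≥0∞) : ENNReal.HolderTriple q q (q / 2) :=
  ⟨by rw [ENNReal.inv_div (Or.inl (by norm_num)) (Or.inl (by norm_num)), div_eq_mul_inv, two_mul]⟩

/-- **Trilinear Hölder bound of the transport pairing** with exponents `(q, p, q)`,
`2/q + 1/p = 1`: for `a, b ∈ L^q(E; E)` and an operator field `Ψ ∈ L^p(E; E →L E)` the integrand
`⟪a(x), Ψ(x) b(x)⟫` is integrable and `∫ |⟪a, Ψ b⟫| ≤ ‖a‖_q ‖b‖_q ‖Ψ‖_p`. [folklore] -/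
private theorem integral_abs_inner_clm_apply_le' {a b : E → E} {Ψ : E → E →L[ℝ] E} {q p : ℝ≥0∞}
    [hp : (q / 2).HolderConjugate p] (ha : MemLp a q volume) (hb : MemLp b q volume)
    (hΨ : MemLp Ψ p volume) :
    Integrable (fun x => ⟪a x, Ψ x (b x)⟫) volume ∧
      ∫ x, |⟪a x, Ψ x (b x)⟫| ≤
        (eLpNorm a q volume * eLpNorm b q volume * eLpNorm Ψ p volume).toReal := by
  haveI := holderTriple_self_half' q
  have hm : MemLp (fun x => ‖a x‖ * ‖b x‖) (q / 2) volume := hb.norm.mul' ha.norm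
  have hprod : MemLp (fun x => ‖Ψ x‖ * (‖a x‖ * ‖b x‖)) 1 volume := hm.mul' hΨ.norm
  have hprod_le : eLpNorm (fun x => ‖Ψ x‖ * (‖a x‖ * ‖b x‖)) 1 volume ≤
      eLpNorm Ψ p volume * (eLpNorm a q volume * eLpNorm b q volume) := by
    have hm_le : eLpNorm (fun x => ‖a x‖ * ‖b x‖) (q / 2) volume ≤
        eLpNorm a q volume * eLpNorm b q volume := by
      have h := eLpNorm_le_eLpNorm_mul_eLpNorm_of_nnnorm ha.1.norm hb.1.norm (fun s t : ℝ => s * t) 1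
        (Eventually.of_forall fun x => by simp) (hpqr := holderTriple_self_half' q)
      simpa only [ENNReal.coe_one, one_mul, eLpNorm_norm] using h
    have h := eLpNorm_le_eLpNorm_mul_eLpNorm_of_nnnorm hΨ.1.norm hm.1 (fun s t : ℝ => s * t) 1
      (Eventually.of_forall fun x => by simp) (hpqr := hp.symm)
    simp only [ENNReal.coe_one, one_mul, eLpNorm_norm] at h
    exact h.trans (by gcongr)
  have hint1 : Integrable (fun x => ‖Ψ x‖ * (‖a x‖ * ‖b x‖)) volume :=
    memLp_one_iff_integrable.1 hprod
  have hmeas : AEStronglyMeasurable (fun x => ⟪a x, Ψ x (b x)⟫) volume := by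
    refine ha.1.inner ?_
    exact (isBoundedBilinearMap_apply (𝕜 := ℝ) (E := E) (F := E)).continuous
      |>.comp_aestronglyMeasurable (hΨ.1.prodMk hb.1)
  have hpt : ∀ x, ‖⟪a x, Ψ x (b x)⟫‖ ≤ ‖Ψ x‖ * (‖a x‖ * ‖b x‖) := fun x => by
    calc ‖⟪a x, Ψ x (b x)⟫‖ ≤ ‖a x‖ * ‖Ψ x (b x)‖ := norm_inner_le_norm _ _
      _ ≤ ‖a x‖ * (‖Ψ x‖ * ‖b x‖) :=
          mul_le_mul_of_nonneg_left (ContinuousLinearMap.le_opNorm _ _) (norm_nonneg _)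
      _ = ‖Ψ x‖ * (‖a x‖ * ‖b x‖) := by ring
  have hint : Integrable (fun x => ⟪a x, Ψ x (b x)⟫) volume :=
    hint1.mono' hmeas (Eventually.of_forall hpt)
  refine ⟨hint, ?_⟩
  have hfin : eLpNorm Ψ p volume * (eLpNorm a q volume * eLpNorm b q volume) ≠ ⊤ :=
    ENNReal.mul_ne_top hΨ.2.ne (ENNReal.mul_ne_top ha.2.ne hb.2.ne)
  calc ∫ x, |⟪a x, Ψ x (b x)⟫| ≤ ∫ x, ‖Ψ x‖ * (‖a x‖ * ‖b x‖) :=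
        integral_mono hint.norm hint1 fun x => hpt x
    _ = (eLpNorm (fun x => ‖Ψ x‖ * (‖a x‖ * ‖b x‖)) 1 volume).toReal := by
        rw [eLpNorm_one_eq_lintegral_enorm, ← integral_norm_eq_lintegral_enorm hint1.1]
        refine integral_congr_ae (Eventually.of_forall fun x => ?_)
        simp only [norm_mul, norm_norm]
    _ ≤ (eLpNorm Ψ p volume * (eLpNorm a q volume * eLpNorm b q volume)).toReal :=
        ENNReal.toReal_mono hfin hprod_le
    _ = (eLpNorm a q volume * eLpNorm b q volume * eLpNorm Ψ p volume).toReal := by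
        rw [mul_comm]

end Trilinear

/-! ### Slab pairings of the class `L^∞_t L^q_x` with space–time test fields -/

section SlabPairings

variable {u : ℝ → E → E} {S : Set ℝ} {q : ℝ≥0∞}

/-- Almost every point of the slab `S × E` has its time coordinate in `S`. [folklore] -/
private theorem ae_fst_mem (hS : MeasurableSet S) :
    ∀ᵐ y ∂((volume.restrict S).prod (volume : Measure E)), y.1 ∈ S :=
  (Measure.quasiMeasurePreserving_fst (μ := volume.restrict S) (ν := (volume : Measure E))).ae
    (ae_restrict_mem hS)

/-- **Slab integrability of the pairing `⟪u, Θ⟫`** of a jointly measurable `u ∈ L^∞(S; L^q)`,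
`1 ≤ q`, `S` of finite measure, with a space–time test field `Θ` (Hölder `L^q × L^{q'}` slicewise
with the uniform `L^{q'}` bound of the slices of `Θ`). [folklore] -/
private theorem MemLqLp.integrable_prod_inner_test (hSfin : volume S ≠ ⊤)
    (hq : 1 ≤ q) (hu : MemLqLp ∞ q u S)
    (hmeas : AEStronglyMeasurable (uncurry u) ((volume.restrict S).prod (volume : Measure E)))
    {Θ : ℝ → E → E} (hΘ : IsSpaceTimeTestOn (⊤ : Opens (ℝ × E)) Θ) :
    Integrable (fun y : ℝ × E => ⟪u y.1 y.2, Θ y.1 y.2⟫)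
      ((volume.restrict S).prod (volume : Measure E)) := by
  haveI : IsFiniteMeasure (volume.restrict S) := isFiniteMeasure_restrict.2 hSfin
  set q' : ℝ≥0∞ := ENNReal.conjExponent q with hq'_def
  haveI hqq' : q.HolderConjugate q' := .conjExponent hq
  obtain ⟨R, hR, hRt⟩ := hΘ.exists_eLpNorm_slice_le q'
  set M : ℝ≥0∞ := eLqLpNorm ∞ q u S with hM_def
  have hMlt : M < ∞ := hu.2
  have hΘm : AEStronglyMeasurable (uncurry Θ) ((volume.restrict S).prod (volume : Measure E)) :=
    hΘ.continuous_uncurry.aestronglyMeasurable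
  have hFm : AEStronglyMeasurable (fun y : ℝ × E => ⟪u y.1 y.2, Θ y.1 y.2⟫)
      ((volume.restrict S).prod (volume : Measure E)) := hmeas.inner hΘm
  have hΘq : ∀ t, MemLp (Θ t) q' volume := fun t =>
    (hΘ.contDiff_slice t).continuous.memLp_of_hasCompactSupport (hΘ.hasCompactSupport_slice t)
  rw [integrable_prod_iff hFm]
  constructor
  · filter_upwards [hu.1] with t ht
    exact integrable_inner_of_memLp_conj ht (hΘq t)
  · refine Integrable.mono' (integrable_const ((M * R).toReal)) hFm.norm.integral_prod_right' ?_
    filter_upwards [hu.1, hu.ae_eLpNorm_le_top] with t ht htM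
    rw [Real.norm_of_nonneg (integral_nonneg fun _ => norm_nonneg _)]
    calc ∫ x, ‖⟪u t x, Θ t x⟫‖ = ∫ x, |⟪u t x, Θ t x⟫| := by simp only [Real.norm_eq_abs]
      _ ≤ (eLpNorm (u t) q volume * eLpNorm (Θ t) q' volume).toReal :=
          integral_abs_inner_le_of_memLp_conj' ht (hΘq t)
      _ ≤ (M * R).toReal :=
          ENNReal.toReal_mono (ENNReal.mul_ne_top hMlt.ne hR.ne) (mul_le_mul' htM (hRt t))

/-- **Slab integrability of the transport pairing `⟪u, DΘ u⟫`** of a jointly measurable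
`u ∈ L^∞(S; L^q)`, `2 ≤ q`, `S` of finite measure, with the gradient of a space–time test field
(trilinear Hölder `(q, p, q)`, `2/q + 1/p = 1`, slicewise, with the uniform `L^p` bound of the
gradients of the slices). [folklore] -/
private theorem MemLqLp.integrable_prod_inner_convect_test (hSfin : volume S ≠ ⊤)
    (hq : 2 ≤ q) (hu : MemLqLp ∞ q u S)
    (hmeas : AEStronglyMeasurable (uncurry u) ((volume.restrict S).prod (volume : Measure E)))
    {Θ : ℝ → E → E} (hΘ : IsSpaceTimeTestOn (⊤ : Opens (ℝ × E)) Θ) :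
    Integrable (fun y : ℝ × E => ⟪u y.1 y.2, fderiv ℝ (Θ y.1) y.2 (u y.1 y.2)⟫)
      ((volume.restrict S).prod (volume : Measure E)) := by
  haveI : IsFiniteMeasure (volume.restrict S) := isFiniteMeasure_restrict.2 hSfin
  have hq2 : 1 ≤ q / 2 := by
    rw [ENNReal.le_div_iff_mul_le (Or.inl two_ne_zero) (Or.inl ENNReal.ofNat_ne_top), one_mul]
    exact hq
  set p : ℝ≥0∞ := ENNReal.conjExponent (q / 2) with hp_def
  haveI hpc : (q / 2).HolderConjugate p := .conjExponent hq2
  have hΘ' : IsSpaceTimeTestOn (⊤ : Opens (ℝ × E)) (fun t x => fderiv ℝ (Θ t) x) := hΘ.fderiv_top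
  obtain ⟨R, hR, hRt⟩ := hΘ'.exists_eLpNorm_slice_le p
  set M : ℝ≥0∞ := eLqLpNorm ∞ q u S with hM_def
  have hMlt : M < ∞ := hu.2
  have happ := (isBoundedBilinearMap_apply (𝕜 := ℝ) (E := E) (F := E)).continuous
  have hΘm : AEStronglyMeasurable (uncurry fun t x => fderiv ℝ (Θ t) x)
      ((volume.restrict S).prod (volume : Measure E)) := hΘ'.continuous_uncurry.aestronglyMeasurable
  have hFm : AEStronglyMeasurable (fun y : ℝ × E => ⟪u y.1 y.2, fderiv ℝ (Θ y.1) y.2 (u y.1 y.2)⟫)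
      ((volume.restrict S).prod (volume : Measure E)) :=
    hmeas.inner (happ.comp_aestronglyMeasurable (hΘm.prodMk hmeas))
  have hΘp : ∀ t, MemLp (fun x => fderiv ℝ (Θ t) x) p volume := fun t =>
    (hΘ'.contDiff_slice t).continuous.memLp_of_hasCompactSupport (hΘ'.hasCompactSupport_slice t)
  rw [integrable_prod_iff hFm]
  constructor
  · filter_upwards [hu.1] with t ht
    exact (integral_abs_inner_clm_apply_le' ht ht (hΘp t)).1
  · refine Integrable.mono' (integrable_const ((M * M * R).toReal)) hFm.norm.integral_prod_right' ?_
    filter_upwards [hu.1, hu.ae_eLpNorm_le_top] with t ht htM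
    rw [Real.norm_of_nonneg (integral_nonneg fun _ => norm_nonneg _)]
    calc ∫ x, ‖⟪u t x, fderiv ℝ (Θ t) x (u t x)⟫‖ = ∫ x, |⟪u t x, fderiv ℝ (Θ t) x (u t x)⟫| := by
          simp only [Real.norm_eq_abs]
      _ ≤ (eLpNorm (u t) q volume * eLpNorm (u t) q volume *
            eLpNorm (fun x => fderiv ℝ (Θ t) x) p volume).toReal :=
          (integral_abs_inner_clm_apply_le' ht ht (hΘp t)).2
      _ ≤ (M * M * R).toReal :=
          ENNReal.toReal_mono (ENNReal.mul_ne_top (ENNReal.mul_ne_top hMlt.ne hMlt.ne) hR.ne)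
            (mul_le_mul' (mul_le_mul' htM htM) (hRt t))

/-- **Slab integrability of the force pairing `⟪f, Θ⟫`** for `f ∈ L¹(S × E)` and a space–time test
field `Θ`. [folklore] -/
private theorem integrable_prod_inner_force_test {f : ℝ → E → E}
    (hf : Integrable (uncurry f) ((volume.restrict S).prod (volume : Measure E)))
    {Θ : ℝ → E → E} (hΘ : IsSpaceTimeTestOn (⊤ : Opens (ℝ × E)) Θ) :
    Integrable (fun y : ℝ × E => ⟪f y.1 y.2, Θ y.1 y.2⟫)
      ((volume.restrict S).prod (volume : Measure E)) := by
  obtain ⟨C, -, hC⟩ := hΘ.exists_norm_le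
  have hΘm : AEStronglyMeasurable (uncurry Θ) ((volume.restrict S).prod (volume : Measure E)) :=
    hΘ.continuous_uncurry.aestronglyMeasurable
  refine Integrable.mono' (hf.norm.mul_const C) (hf.1.inner hΘm) (Eventually.of_forall fun y => ?_)
  exact (norm_inner_le_norm _ _).trans (mul_le_mul_of_nonneg_left (hC _ _) (norm_nonneg _))

end SlabPairings

/-! ### The nonlinear term -/

section Nonlinear

variable {ν : ℝ} {u : ℝ → E → E} {q : ℝ≥0∞}

/-- **The nonlinear term of the duality identity, integrated in time.** For `0 < ν`, a jointly
measurable `u ∈ L^∞((0,T); L^q)`, `2 ≤ q`, and a space–time test field `Λ` with time support in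
`[a', b']`, `b' ≤ T`:
`∫_{(0,T)} ∫₀ᵗ ∫ ⟪u(τ,x), (u(τ,x)·∇)(e^{ν(t-τ)Δ}Λ(t))(x)⟫ dx dτ dt
  = ∫_{(0,T)} ∫ ⟪u(τ,x), D(𝒰[Λ](τ))(x) u(τ,x)⟫ dx dτ`
(Fubini on `(0,T) × ((0,T) × E)` for the transport integrand `⟪u, K_t u⟫`,
`K_t(τ,x) = 1_{τ<t} D(e^{ν(t-τ)Δ}Λ(t))(x)`, dominated slicewise in time by the trilinear Hölder
bound `‖K_t(τ)‖_p ‖u(τ)‖_q²`, `2/q + 1/p = 1`; the time integral moved inside the pairing; and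
`∫ K_t(τ,x) dt = D𝒰[Λ](τ)(x)`, the tree's
`IsSpaceTimeTestOn.setIntegral_transportKernel_eq_fderiv_heatDuhamelBack`; Lemarié-Rieusset 2016,
proof of Thm. 7.7, fourth step; Fabes–Jones–Rivière 1972, proof of Thm. 2.1). [cite: LemarieRieusset2016, proof of Thm. 7.7, fourth step, p. 149] -/
theorem MemLqLp.integral_Ioo_intervalIntegral_integral_inner_convect_heatTest_eq (hν : 0 < ν)
    {T : ℝ} (hq : 2 ≤ q) (hu : MemLqLp ∞ q u (Ioo 0 T))
    (hmeas : AEStronglyMeasurable (uncurry u) ((volume.restrict (Ioo 0 T)).prod (volume : Measure E)))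
    {Λ : ℝ → E → E} (hΛ : IsSpaceTimeTestOn (⊤ : Opens (ℝ × E)) Λ)
    {a' b' : ℝ} (hsupp : ∀ t, t ∉ Icc a' b' → Λ t = 0) (hb'T : b' ≤ T) :
    (∫ t in Ioo 0 T, ∫ τ in (0 : ℝ)..t, ∫ x, ⟪u τ x, convect (u τ) (heatTest ν (Λ t) (t - τ)) x⟫) =
      ∫ τ in Ioo 0 T, ∫ x, ⟪u τ x, fderiv ℝ (heatDuhamelBack ν Λ τ) x (u τ x)⟫ ∧
    IntegrableOn (fun t => ∫ τ in (0 : ℝ)..t, ∫ x, ⟪u τ x, convect (u τ) (heatTest ν (Λ t) (t - τ)) x⟫)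
      (Ioo 0 T) volume := by
  haveI : IsFiniteMeasure (volume.restrict (Ioo 0 T)) :=
    isFiniteMeasure_restrict.2 measure_Ioo_lt_top.ne
  have hq2 : 1 ≤ q / 2 := by
    rw [ENNReal.le_div_iff_mul_le (Or.inl two_ne_zero) (Or.inl ENNReal.ofNat_ne_top), one_mul]
    exact hq
  set p : ℝ≥0∞ := ENNReal.conjExponent (q / 2) with hp_def
  haveI hpc : (q / 2).HolderConjugate p := .conjExponent hq2
  have hp1 : 1 ≤ p := ENNReal.HolderConjugate.one_le p (q / 2)
  have hΛ' : IsSpaceTimeTestOn (⊤ : Opens (ℝ × E)) (fun t x => fderiv ℝ (Λ t) x) := hΛ.fderiv_top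
  obtain ⟨R, hR, hRt⟩ := hΛ'.exists_eLpNorm_slice_le p
  set M : ℝ≥0∞ := eLqLpNorm ∞ q u (Ioo 0 T) with hM_def
  have hMlt : M < ∞ := hu.2
  -- the transport kernel `K(t, (τ, x)) = 1_{τ<t} D(e^{ν(t-τ)Δ}Λ(t))(x)`
  set K : ℝ × (ℝ × E) → E →L[ℝ] E := fun p =>
    if p.2.1 < p.1 then fderiv ℝ (heatTest ν (Λ p.1) (p.1 - p.2.1)) p.2.2 else 0 with hK_def
  have hKp : ∀ t τ, MemLp (fun x => K (t, (τ, x))) p volume ∧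
      eLpNorm (fun x => K (t, (τ, x))) p volume ≤ R := by
    intro t τ
    by_cases h : τ < t
    · simp only [hK_def, if_pos h]
      exact ⟨memLp_fderiv_heatTest hν (sub_pos.2 h).le (contDiff_infty.1 (hΛ.contDiff_slice t) 1)
          (hΛ.hasCompactSupport_slice t) hp1,
        (eLpNorm_fderiv_heatTest_le hν (sub_pos.2 h).le (contDiff_infty.1 (hΛ.contDiff_slice t) 1)
          (hΛ.hasCompactSupport_slice t) hp1).trans (hRt t)⟩
    · have hK0 : ∀ x : E, K (t, (τ, x)) = 0 := fun x => by simp only [hK_def, if_neg h]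
      have hle : ∀ x : E, ‖K (t, (τ, x))‖ ≤ ‖fderiv ℝ (Λ t) x‖ := fun x => by
        rw [hK0 x]; simp
      have hΛp : MemLp (fun x => fderiv ℝ (Λ t) x) p volume :=
        (hΛ'.contDiff_slice t).continuous.memLp_of_hasCompactSupport (hΛ'.hasCompactSupport_slice t)
      have hmK : AEStronglyMeasurable (fun x : E => K (t, (τ, x))) volume :=
        (aestronglyMeasurable_const (b := (0 : E →L[ℝ] E))).congr
          (Eventually.of_forall fun x => (hK0 x).symm)
      exact ⟨MemLp.of_le hΛp hmK (Eventually.of_forall hle), (eLpNorm_mono hle).trans (hRt t)⟩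
  set μ : Measure ℝ := volume.restrict (Ioo 0 T) with hμ
  -- the transport integrand `Ψ(t, (τ, x)) = ⟪u τ x, K(t, τ, x) u τ x⟫`
  set Ψ : ℝ × (ℝ × E) → ℝ := fun p => ⟪uncurry u p.2, K p (uncurry u p.2)⟫ with hΨ_def
  have happ := (isBoundedBilinearMap_apply (𝕜 := ℝ) (E := E) (F := E)).continuous
  have hKm : AEStronglyMeasurable K (μ.prod (μ.prod (volume : Measure E))) :=
    hΛ.aestronglyMeasurable_transportKernel hν _
  have hKslice : ∀ t, AEStronglyMeasurable (fun y : ℝ × E => K (t, y)) (μ.prod (volume : Measure E)) :=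
    fun t => hΛ.aestronglyMeasurable_transportKernel_slice hν t _
  have hu2 : AEStronglyMeasurable (fun p : ℝ × (ℝ × E) => uncurry u p.2)
      (μ.prod (μ.prod (volume : Measure E))) := hmeas.comp_snd
  have hΨm : AEStronglyMeasurable Ψ (μ.prod (μ.prod (volume : Measure E))) :=
    hu2.inner (happ.comp_aestronglyMeasurable (hKm.prodMk hu2))
  have hΨsm : ∀ t, AEStronglyMeasurable (fun y : ℝ × E => Ψ (t, y)) (μ.prod (volume : Measure E)) :=
    fun t => hmeas.inner (happ.comp_aestronglyMeasurable ((hKslice t).prodMk hmeas))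
  -- slices `Ψ(t, ·)` are integrable on `(0,T) × E`, with integral of `|Ψ|` at most `M² R T`
  have hΨslice : ∀ t, Integrable (fun y : ℝ × E => Ψ (t, y)) (μ.prod (volume : Measure E)) ∧
      ∫ y, ‖Ψ (t, y)‖ ∂(μ.prod (volume : Measure E)) ≤ (M * M * R).toReal * (volume (Ioo 0 T)).toReal := by
    intro t
    have hsl : ∀ᵐ τ ∂μ, Integrable (fun x => Ψ (t, (τ, x))) volume ∧
        ∫ x, ‖Ψ (t, (τ, x))‖ ≤ (M * M * R).toReal := by
      rw [hμ]
      filter_upwards [hu.1, hu.ae_eLpNorm_le_top] with τ hτ hτM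
      obtain ⟨h1, h2⟩ := integral_abs_inner_clm_apply_le' hτ hτ (hKp t τ).1
      refine ⟨h1, ?_⟩
      calc ∫ x, ‖Ψ (t, (τ, x))‖ = ∫ x, |⟪u τ x, K (t, (τ, x)) (u τ x)⟫| := by
            simp only [hΨ_def, uncurry_apply_pair, Real.norm_eq_abs]
        _ ≤ (eLpNorm (u τ) q volume * eLpNorm (u τ) q volume *
              eLpNorm (fun x => K (t, (τ, x))) p volume).toReal := h2
        _ ≤ (M * M * R).toReal :=
            ENNReal.toReal_mono (ENNReal.mul_ne_top (ENNReal.mul_ne_top hMlt.ne hMlt.ne) hR.ne)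
              (mul_le_mul' (mul_le_mul' hτM hτM) (hKp t τ).2)
    have hI : Integrable (fun y : ℝ × E => Ψ (t, y)) (μ.prod (volume : Measure E)) := by
      rw [integrable_prod_iff (hΨsm t)]
      refine ⟨hsl.mono fun τ hτ => hτ.1, ?_⟩
      refine Integrable.mono' (integrable_const ((M * M * R).toReal)) (hΨsm t).norm.integral_prod_right' ?_
      filter_upwards [hsl] with τ hτ
      rw [Real.norm_of_nonneg (integral_nonneg fun _ => norm_nonneg _)]
      exact hτ.2
    refine ⟨hI, ?_⟩
    rw [integral_prod _ hI.norm]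
    have h := integral_mono_ae (hI.norm.integral_prod_left) (integrable_const ((M * M * R).toReal))
      (hsl.mono fun τ hτ => hτ.2)
    refine h.trans (le_of_eq ?_)
    rw [integral_const, smul_eq_mul, hμ, measureReal_def, Measure.restrict_apply_univ, mul_comm]
  have hΨ : Integrable Ψ (μ.prod (μ.prod (volume : Measure E))) := by
    rw [integrable_prod_iff hΨm]
    refine ⟨Eventually.of_forall fun t => (hΨslice t).1, ?_⟩
    refine Integrable.mono' (integrable_const ((M * M * R).toReal * (volume (Ioo 0 T)).toReal))
      hΨm.norm.integral_prod_right' (Eventually.of_forall fun t => ?_)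
    rw [Real.norm_of_nonneg (integral_nonneg fun _ => norm_nonneg _)]
    exact (hΨslice t).2
  -- Step 1: the inner two integrals at fixed `t ∈ (0, T)` as a slab integral of `Ψ(t, ·)`
  have e1 : ∀ t ∈ Ioo 0 T,
      (∫ τ in (0 : ℝ)..t, ∫ x, ⟪u τ x, convect (u τ) (heatTest ν (Λ t) (t - τ)) x⟫) =
        ∫ y, Ψ (t, y) ∂(μ.prod (volume : Measure E)) := by
    intro t ht
    rw [integral_prod _ (hΨslice t).1, intervalIntegral.integral_of_le ht.1.le]
    have hvan : ∀ τ, ¬ τ < t → (∫ x, Ψ (t, (τ, x))) = 0 := by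
      intro τ hτt
      simp [hΨ_def, hK_def, if_neg hτt]
    have e2 : (∫ τ in Ioo 0 T, ∫ x, Ψ (t, (τ, x))) = ∫ τ in Ioc 0 t, ∫ x, Ψ (t, (τ, x)) := by
      have hind : EqOn (fun τ => ∫ x, Ψ (t, (τ, x)))
          ((Iic t).indicator fun τ => ∫ x, Ψ (t, (τ, x))) (Ioo 0 T) := fun τ _ => by
        by_cases h : τ ≤ t
        · rw [indicator_of_mem (show τ ∈ Iic t from h)]
        · rw [indicator_of_notMem (show τ ∉ Iic t from h)]
          exact hvan τ fun hlt => h hlt.le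
      have hset : Ioo 0 T ∩ Iic t = Ioc 0 t := by
        ext τ
        simp only [mem_inter_iff, mem_Ioo, mem_Iic, mem_Ioc]
        constructor
        · rintro ⟨⟨h1, -⟩, h3⟩; exact ⟨h1, h3⟩
        · rintro ⟨h1, h2⟩; exact ⟨⟨h1, lt_of_le_of_lt h2 ht.2⟩, h2⟩
      rw [setIntegral_congr_fun measurableSet_Ioo hind, setIntegral_indicator measurableSet_Iic, hset]
    rw [hμ, e2]
    refine setIntegral_congr_ae measurableSet_Ioc ?_
    filter_upwards [measure_eq_zero_iff_ae_notMem.1 (measure_singleton t)] with τ hτt hτ'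
    have hlt : τ < t := lt_of_le_of_ne hτ'.2 hτt
    simp only [hΨ_def, hK_def, if_pos hlt, uncurry_apply_pair, convect_apply]
  refine ⟨?_, ?_⟩
  · rw [setIntegral_congr_fun measurableSet_Ioo e1]
    -- Step 2: swap `t` and `(τ, x)`
    have hΨ' : Integrable (uncurry fun (t : ℝ) (y : ℝ × E) => Ψ (t, y))
        (μ.prod (μ.prod (volume : Measure E))) := hΨ
    rw [integral_integral_swap hΨ']
    -- Step 3: the time integral moves inside the pairing and equals `D𝒰[Λ](τ)(x)`
    have e3 : ∀ᵐ y ∂(μ.prod (volume : Measure E)),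
        (∫ t, Ψ (t, y) ∂μ) = ⟪uncurry u y, fderiv ℝ (heatDuhamelBack ν Λ y.1) y.2 (uncurry u y)⟫ := by
      filter_upwards [ae_fst_mem measurableSet_Ioo] with y hy
      have hint : IntegrableOn (fun t => K (t, y)) (Ioc 0 T) volume :=
        hΛ.integrableOn_transportKernel_time hν 0 T y.1 y.2
      have hval : ∫ t in Ioc 0 T, K (t, y) = fderiv ℝ (heatDuhamelBack ν Λ y.1) y.2 :=
        hΛ.setIntegral_transportKernel_eq_fderiv_heatDuhamelBack hν hsupp hb'T
          (Ioo_subset_Icc_self hy) y.2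
      have hint' : IntegrableOn (fun t => K (t, y)) (Ioo 0 T) volume := hint.mono_set Ioo_subset_Ioc_self
      simp only [hΨ_def]
      rw [hμ, integral_inner (hint'.apply_continuousLinearMap _),
        ← ContinuousLinearMap.integral_apply hint', setIntegral_congr_set Ioo_ae_eq_Ioc, hval]
    refine (integral_congr_ae e3).trans ?_
    -- Step 4: back to iterated integrals
    have hL : Integrable (fun y : ℝ × E =>
        ⟪uncurry u y, fderiv ℝ (heatDuhamelBack ν Λ y.1) y.2 (uncurry u y)⟫)
        (μ.prod (volume : Measure E)) := hΨ.integral_prod_right.congr e3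
    rw [integral_prod _ hL]
    simp only [uncurry_apply_pair]
  · have hT : Integrable (fun t => ∫ y, Ψ (t, y) ∂(μ.prod (volume : Measure E))) μ :=
      hΨ.integral_prod_left
    rw [hμ] at hT
    exact hT.congr ((ae_restrict_iff' measurableSet_Ioo).2 (Eventually.of_forall fun t ht => (e1 t ht).symm))

end Nonlinear

/-! ### The force term -/

section Force

variable {ν : ℝ}

omit [FiniteDimensional ℝ E] [BorelSpace E] [InnerProductSpace ℝ E] in
/-- For `0 < t < T`: `(0, T) ∩ (-∞, t] = (0, t]`. [folklore] -/
private theorem Ioo_inter_Iic_eq_Ioc {T t : ℝ} (ht : t ∈ Ioo 0 T) : Ioo 0 T ∩ Iic t = Ioc 0 t := by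
  ext τ
  simp only [mem_inter_iff, mem_Ioo, mem_Iic, mem_Ioc]
  constructor
  · rintro ⟨⟨h1, -⟩, h3⟩; exact ⟨h1, h3⟩
  · rintro ⟨h1, h2⟩; exact ⟨⟨h1, lt_of_le_of_lt h2 ht.2⟩, h2⟩

/-- **The force term of the duality identity, integrated in time.** For a force `f` integrable on
the slab `(0,T) × E`, `0 < ν`, and a space–time test field `Λ` with time support in `[a', b']`,
`b' ≤ T`:
`∫_{(0,T)} ∫₀ᵗ ∫ ⟪f(τ,x), (e^{ν(t-τ)Δ}Λ(t))(x)⟫ dx dτ dt = ∫_{(0,T)} ∫ ⟪f(τ,x), 𝒰[Λ](τ)(x)⟫ dx dτ`,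
and the left-hand time integrand is integrable on `(0,T)` (Fubini on `(0,T) × ((0,T) × E)` for
the integrand dominated by `‖Λ‖_∞ ‖f‖`, the time integral moved inside the pairing, and the
kernel identity `IsSpaceTimeTestOn.setIntegral_caloricKernel_eq_heatDuhamelBack`;
Lemarié-Rieusset 2016, proof of Thm. 7.7, fourth step; Fabes–Jones–Rivière 1972, proof of
Thm. 2.1). [cite: LemarieRieusset2016, proof of Thm. 7.7, fourth step, p. 149] -/
theorem integral_Ioo_intervalIntegral_integral_inner_force_heatTest_eq (hν : 0 < ν) {T : ℝ}
    {f : ℝ → E → E}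
    (hf : Integrable (uncurry f) ((volume.restrict (Ioo 0 T)).prod (volume : Measure E)))
    {Λ : ℝ → E → E} (hΛ : IsSpaceTimeTestOn (⊤ : Opens (ℝ × E)) Λ)
    {a' b' : ℝ} (hsupp : ∀ t, t ∉ Icc a' b' → Λ t = 0) (hb'T : b' ≤ T) :
    (∫ t in Ioo 0 T, ∫ τ in (0 : ℝ)..t, ∫ x, ⟪f τ x, heatTest ν (Λ t) (t - τ) x⟫) =
      ∫ τ in Ioo 0 T, ∫ x, ⟪f τ x, heatDuhamelBack ν Λ τ x⟫ ∧
    IntegrableOn (fun t => ∫ τ in (0 : ℝ)..t, ∫ x, ⟪f τ x, heatTest ν (Λ t) (t - τ) x⟫)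
      (Ioo 0 T) volume := by
  obtain ⟨C, hC0, hC⟩ := hΛ.exists_norm_le
  -- the caloric kernel `K(t, (τ, x)) = 1_{τ<t} (e^{ν(t-τ)Δ}Λ(t))(x)`
  set K : ℝ × (ℝ × E) → E := fun q =>
    if q.2.1 < q.1 then heatTest ν (Λ q.1) (q.1 - q.2.1) q.2.2 else 0 with hK_def
  have hKle : ∀ q, ‖K q‖ ≤ C := fun q => hΛ.norm_caloricKernel_le hC0 hC q.1 q.2.1 q.2.2
  set μ : Measure ℝ := volume.restrict (Ioo 0 T) with hμ
  haveI : IsFiniteMeasure μ := by rw [hμ]; exact isFiniteMeasure_restrict.2 measure_Ioo_lt_top.ne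
  -- the integrand `Φ(t, (τ, x)) = ⟪f τ x, K(t, τ, x)⟫` on `(0,T) × ((0,T) × E)`
  set Φ : ℝ × (ℝ × E) → ℝ := fun p => ⟪uncurry f p.2, K p⟫ with hΦ_def
  have hKm : AEStronglyMeasurable K (μ.prod (μ.prod (volume : Measure E))) :=
    hΛ.aestronglyMeasurable_caloricKernel hν _
  have hΦm : AEStronglyMeasurable Φ (μ.prod (μ.prod (volume : Measure E))) :=
    (hf.1.comp_snd).inner hKm
  have hKslice : ∀ t, AEStronglyMeasurable (fun y : ℝ × E => K (t, y)) (μ.prod (volume : Measure E)) :=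
    fun t => hΛ.aestronglyMeasurable_caloricKernel_slice hν t _
  have hΦslice : ∀ t, Integrable (fun y : ℝ × E => Φ (t, y)) (μ.prod (volume : Measure E)) := by
    intro t
    refine Integrable.mono' (hf.norm.const_mul C) ((hf.1).inner (hKslice t))
      (Eventually.of_forall fun y => ?_)
    calc ‖Φ (t, y)‖ ≤ ‖uncurry f y‖ * ‖K (t, y)‖ := norm_inner_le_norm _ _
      _ ≤ ‖uncurry f y‖ * C := mul_le_mul_of_nonneg_left (hKle _) (norm_nonneg _)
      _ = C * ‖uncurry f y‖ := mul_comm _ _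
  have hΦ : Integrable Φ (μ.prod (μ.prod (volume : Measure E))) := by
    rw [integrable_prod_iff hΦm]
    refine ⟨Eventually.of_forall hΦslice, ?_⟩
    refine Integrable.mono' (integrable_const (C * ∫ y, ‖uncurry f y‖ ∂(μ.prod (volume : Measure E))))
      hΦm.norm.integral_prod_right' (Eventually.of_forall fun t => ?_)
    rw [Real.norm_of_nonneg (integral_nonneg fun _ => norm_nonneg _)]
    calc ∫ y, ‖Φ (t, y)‖ ∂(μ.prod (volume : Measure E))
        ≤ ∫ y, C * ‖uncurry f y‖ ∂(μ.prod (volume : Measure E)) :=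
          integral_mono_of_nonneg (Eventually.of_forall fun _ => norm_nonneg _) (hf.norm.const_mul C)
            (Eventually.of_forall fun y =>
              (norm_inner_le_norm _ _).trans
                ((mul_le_mul_of_nonneg_left (hKle _) (norm_nonneg _)).trans_eq (mul_comm _ _)))
      _ = C * ∫ y, ‖uncurry f y‖ ∂(μ.prod (volume : Measure E)) := integral_const_mul _ _
  -- Step 1: the inner two integrals at fixed `t ∈ (0, T)` as a slab integral of `Φ(t, ·)`
  have e1 : ∀ t ∈ Ioo 0 T, (∫ τ in (0 : ℝ)..t, ∫ x, ⟪f τ x, heatTest ν (Λ t) (t - τ) x⟫) =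
      ∫ y, Φ (t, y) ∂(μ.prod (volume : Measure E)) := by
    intro t ht
    rw [integral_prod _ (hΦslice t), intervalIntegral.integral_of_le ht.1.le]
    have hvan : ∀ τ, ¬ τ < t → (∫ x, Φ (t, (τ, x))) = 0 := by
      intro τ hτt
      simp [hΦ_def, hK_def, if_neg hτt]
    have e2 : (∫ τ in Ioo 0 T, ∫ x, Φ (t, (τ, x))) = ∫ τ in Ioc 0 t, ∫ x, Φ (t, (τ, x)) := by
      have hind : EqOn (fun τ => ∫ x, Φ (t, (τ, x)))
          ((Iic t).indicator fun τ => ∫ x, Φ (t, (τ, x))) (Ioo 0 T) := fun τ _ => by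
        by_cases h : τ ≤ t
        · rw [indicator_of_mem (show τ ∈ Iic t from h)]
        · rw [indicator_of_notMem (show τ ∉ Iic t from h)]
          exact hvan τ fun hlt => h hlt.le
      rw [setIntegral_congr_fun measurableSet_Ioo hind, setIntegral_indicator measurableSet_Iic,
        Ioo_inter_Iic_eq_Ioc ht]
    rw [hμ, e2]
    refine setIntegral_congr_ae measurableSet_Ioc ?_
    filter_upwards [measure_eq_zero_iff_ae_notMem.1 (measure_singleton t)] with τ hτt hτ'
    have hlt : τ < t := lt_of_le_of_ne hτ'.2 hτt
    simp only [hΦ_def, hK_def, if_pos hlt, uncurry_apply_pair]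
  refine ⟨?_, ?_⟩
  · rw [setIntegral_congr_fun measurableSet_Ioo e1]
    -- Step 2: swap `t` and `(τ, x)`
    have hΦ' : Integrable (uncurry fun (t : ℝ) (y : ℝ × E) => Φ (t, y))
        (μ.prod (μ.prod (volume : Measure E))) := hΦ
    rw [integral_integral_swap hΦ']
    -- Step 3: the time integral moves inside the pairing and equals `𝒰[Λ](τ)(x)`
    have e3 : ∀ᵐ y ∂(μ.prod (volume : Measure E)),
        (∫ t, Φ (t, y) ∂μ) = ⟪uncurry f y, heatDuhamelBack ν Λ y.1 y.2⟫ := by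
      filter_upwards [ae_fst_mem measurableSet_Ioo] with y hy
      have hint : IntegrableOn (fun t => K (t, y)) (Ioc 0 T) volume :=
        hΛ.integrableOn_caloricKernel_time hν 0 T y.1 y.2
      have hval : ∫ t in Ioc 0 T, K (t, y) = heatDuhamelBack ν Λ y.1 y.2 :=
        hΛ.setIntegral_caloricKernel_eq_heatDuhamelBack hν hsupp hb'T (Ioo_subset_Icc_self hy) y.2
      have hint' : IntegrableOn (fun t => K (t, y)) (Ioo 0 T) volume :=
        hint.mono_set Ioo_subset_Ioc_self
      simp only [hΦ_def]
      rw [hμ, integral_inner hint', setIntegral_congr_set Ioo_ae_eq_Ioc, hval]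
    refine (integral_congr_ae e3).trans ?_
    -- Step 4: back to iterated integrals
    have hL : Integrable (fun y : ℝ × E => ⟪uncurry f y, heatDuhamelBack ν Λ y.1 y.2⟫)
        (μ.prod (volume : Measure E)) := hΦ.integral_prod_right.congr e3
    rw [integral_prod _ hL]
    simp only [uncurry_apply_pair]
  · have hT : Integrable (fun t => ∫ y, Φ (t, y) ∂(μ.prod (volume : Measure E))) μ :=
      hΦ.integral_prod_left
    rw [hμ] at hT
    exact hT.congr ((ae_restrict_iff' measurableSet_Ioo).2
      (Eventually.of_forall fun t ht => (e1 t ht).symm))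

end Force

/-! ### Local square integrability of the class `L^∞_t L^q_x`, `q ≥ 2` -/

section LocalSquare

/-- **`L^∞((0,T); L^q) ⊂ L²_loc` up to the time boundary for `q ≥ 2`**: for a jointly measurable
`u` on `(0,T) × E` with `u ∈ L^∞((0,T); L^q)`, `2 ≤ q`, and every compact `K ⊆ E`,
`∫_{(0,T) × K} ‖u‖² ≤ T · |K|^{1 - 2/q} · ‖u‖²_{L^∞L^q} < ∞` (Hölder on `K` slicewise, Tonelli).
This is the second conjunct of `IsWeakNSSolutionOn` for the Fabes–Jones–Rivière class.
[folklore] -/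
private theorem MemLqLp.lintegral_enorm_sq_prod_lt_top_of_two_le {u : ℝ → E → E} {T : ℝ}
    {q : ℝ≥0∞} (hq : 2 ≤ q) (hu : MemLqLp ∞ q u (Ioo 0 T))
    (hmeas : AEStronglyMeasurable (uncurry u) (volume.restrict (Ioo 0 T ×ˢ univ)))
    {K : Set E} (hK : IsCompact K) :
    ∫⁻ z in Ioo 0 T ×ˢ K, ‖uncurry u z‖ₑ ^ 2 < ∞ := by
  set M : ℝ≥0∞ := eLqLpNorm ∞ q u (Ioo 0 T) with hM_def
  have hMlt : M < ∞ := hu.2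
  -- the slab measure as a product
  have hprod : (volume : Measure (ℝ × E)).restrict (Ioo 0 T ×ˢ K) =
      (volume.restrict (Ioo 0 T)).prod (volume.restrict K) := by
    rw [Measure.volume_eq_prod, Measure.prod_restrict]
  have hle : (volume : Measure (ℝ × E)).restrict (Ioo 0 T ×ˢ K) ≤ volume.restrict (Ioo 0 T ×ˢ univ) :=
    Measure.restrict_mono (prod_mono le_rfl (subset_univ _)) le_rfl
  have hmeas' : AEMeasurable (fun z : ℝ × E => ‖uncurry u z‖ₑ ^ 2)
      ((volume.restrict (Ioo 0 T)).prod (volume.restrict K)) := by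
    rw [← hprod]
    exact ((hmeas.mono_measure hle).aemeasurable.enorm.pow_const 2)
  rw [hprod, lintegral_prod _ hmeas']
  -- slicewise Hölder bound
  haveI hKfin : IsFiniteMeasure ((volume : Measure E).restrict K) :=
    ⟨by rw [Measure.restrict_apply_univ]; exact hK.measure_lt_top⟩
  set c : ℝ≥0∞ := (volume : Measure E) K ^ (1 / (2 : ℝ≥0∞).toReal - 1 / q.toReal) with hc_def
  have hc : c < ∞ := by
    rw [hc_def]
    refine ENNReal.rpow_lt_top_of_nonneg ?_ hK.measure_lt_top.ne
    rw [sub_nonneg, ENNReal.toReal_ofNat]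
    rcases eq_or_ne q ⊤ with hq' | hq'
    · rw [hq', ENNReal.toReal_top, div_zero]; norm_num
    · have h2 : (2 : ℝ) ≤ q.toReal := by
        have := ENNReal.toReal_mono hq' hq
        rwa [ENNReal.toReal_ofNat] at this
      exact one_div_le_one_div_of_le (by norm_num) h2
  have hslice : ∀ᵐ t ∂(volume.restrict (Ioo 0 T)),
      ∫⁻ x, ‖uncurry u (t, x)‖ₑ ^ 2 ∂((volume : Measure E).restrict K) ≤ (M * c) ^ 2 := by
    filter_upwards [hu.1, hu.ae_eLpNorm_le_top] with t ht htM
    have h2K : eLpNorm (u t) 2 (volume.restrict K) ≤ M * c := by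
      calc eLpNorm (u t) 2 (volume.restrict K)
          ≤ eLpNorm (u t) q (volume.restrict K) * (volume.restrict K) univ ^
              (1 / (2 : ℝ≥0∞).toReal - 1 / q.toReal) :=
            eLpNorm_le_eLpNorm_mul_rpow_measure_univ hq (ht.restrict K).1
        _ ≤ M * c := by
            rw [Measure.restrict_apply_univ]
            exact mul_le_mul_of_nonneg_right
              ((eLpNorm_mono_measure (u t) Measure.restrict_le_self).trans htM) bot_le
    have hsq : ∫⁻ x, ‖uncurry u (t, x)‖ₑ ^ 2 ∂((volume : Measure E).restrict K) =
        eLpNorm (u t) 2 (volume.restrict K) ^ 2 := by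
      rw [eLpNorm_eq_lintegral_rpow_enorm_toReal two_ne_zero ENNReal.ofNat_ne_top,
        ENNReal.toReal_ofNat, ← ENNReal.rpow_natCast, ← ENNReal.rpow_mul]
      norm_num
    rw [hsq]
    exact pow_le_pow_left' h2K 2
  -- integrate the slicewise bound in time
  have hT : ∫⁻ t, ∫⁻ x, ‖uncurry u (t, x)‖ₑ ^ 2 ∂((volume : Measure E).restrict K)
      ∂(volume.restrict (Ioo 0 T)) ≤ ∫⁻ _t, (M * c) ^ 2 ∂(volume.restrict (Ioo 0 T)) :=
    lintegral_mono_ae hslice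
  refine lt_of_le_of_lt hT ?_
  rw [lintegral_const, Measure.restrict_apply_univ]
  exact ENNReal.mul_lt_top (ENNReal.pow_lt_top (ENNReal.mul_lt_top hMlt hc)) measure_Ioo_lt_top

end LocalSquare

/-! ### Mild ⇒ weak: the discharge -/

section Main

variable {ν T : ℝ} {f u : ℝ → E → E} {u₀ : E → E}

/-- **Mild solutions are weak solutions** — discharge of the named fact
`Literature.Analysis.FluidPDE.IsMildNSSolutionOn.isWeakNSSolutionOn` (Fabes–Jones–Rivière 1972,
Thm. 2.1, (ii) ⇒ (i); Lemarié-Rieusset 2002, Thm. 11.2 / 2016, Thm. 6.1): a mild solution on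
`[0, T)` in the duality form (slices weakly divergence free, the Duhamel duality identity from the
datum `u₀` against every `φ ∈ C_c^∞` divergence free), in the class `u₀ ∈ L^q`,
`u ∈ L^∞((0,T); L^q)` jointly measurable, `q ≥ 2`, `f ∈ L¹((0,T) × E)`, `0 < ν`, is a weak
(Leray-type, pressure-free) solution on `[0, T)` with datum `u₀`.
Proof (the printed one): measurability is a hypothesis; local square integrability is
`MemLqLp.lintegral_enorm_sq_prod_lt_top_of_two_le`; weak divergence-freeness holds at every time;
for the weak identity against a space–time test field `ψ` with divergence-free slices and time
support below `b' < T`, test the duality identity at time `t ∈ (0,T)` with the slice `Λ(t)` of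
`Λ = ∂ₜψ + νΔψ` (a test field with divergence-free slices) and integrate over `t ∈ (0,T)`:
the left side is `∫∫ ⟪u, ∂ₜψ⟫ + ν⟪u, Δψ⟫`; the datum term gives `-∫⟪u₀, ψ(0)⟫`
(`integral_Ioc_integral_inner_heatTest_heatAdjointField_eq_neg`), the nonlinear term
`∫∫ ⟪u, D𝒰[Λ] u⟫ = -∫∫ ⟪u, (u·∇)ψ⟫` and the force term `∫∫ ⟪f, 𝒰[Λ]⟫ = -∫∫ ⟪f, ψ⟫` by the
backward heat equation `𝒰[∂ₜψ + νΔψ] = -ψ`. [cite: FabesJonesRiviere1972, Thm. 2.1] -/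
theorem IsMildNSSolutionOn.isWeakNSSolutionOn_holds :
    IsMildNSSolutionOn.isWeakNSSolutionOn (E := E) (ν := ν) (T := T) (f := f) (u := u)
      (u₀ := u₀) := by
  intro h hν q hu₀ hmeas hq hu hf
  have hq1 : 1 ≤ q := le_trans (by norm_num) hq
  have hmeas' : AEStronglyMeasurable (uncurry u)
      ((volume.restrict (Ioo 0 T)).prod (volume : Measure E)) := by
    rw [← volume_restrict_prod_univ_eq_prod]; exact hmeas
  have hf' : Integrable (uncurry f) ((volume.restrict (Ioo 0 T)).prod (volume : Measure E)) := by
    have h1 : IntegrableOn (uncurry f) (Ioo 0 T ×ˢ univ) volume := hf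
    rw [IntegrableOn, volume_restrict_prod_univ_eq_prod] at h1
    exact h1
  refine ⟨hmeas, fun K hK => hu.lintegral_enorm_sq_prod_lt_top_of_two_le hq hmeas hK, ?_,
    fun ψ hψ hψd => ?_⟩
  · exact (ae_restrict_iff' measurableSet_Ioo).2
      (Eventually.of_forall fun t ht => h.1 t ⟨ht.1.le, ht.2⟩)
  haveI : IsFiniteMeasure (volume.restrict (Ioo 0 T)) :=
    isFiniteMeasure_restrict.2 measure_Ioo_lt_top.ne
  -- time support of the test field: `[a', b']`, `b' < T`
  obtain ⟨a', b', -, hb'T, hsupp⟩ := hψ.exists_time_support_lt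
  have hψ' : IsSpaceTimeTestOn (⊤ : Opens (ℝ × E)) ψ := hψ.mono le_top
  -- the degenerate case `T ≤ 0`: no time interval, and `ψ(0) = 0`
  rcases le_or_gt T 0 with hT | hT
  · have hψ0 : ψ 0 = 0 := hsupp 0 fun hmem => by linarith [hmem.2]
    have h0 : ∫ x, ⟪u₀ x, ψ 0 x⟫ = 0 := by simp [hψ0]
    rw [h0, add_zero, Ioo_eq_empty_of_le hT, Measure.restrict_empty, integral_zero_measure]
  -- the adjoint field `Λ = ∂ₜψ + νΔψ`
  set Λ : ℝ → E → E := fun t x => timeDeriv ψ t x + ν • Δ (ψ t) x with hΛ_def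
  have hΛ : IsSpaceTimeTestOn (⊤ : Opens (ℝ × E)) Λ := hψ'.heatAdjointField_top ν
  have hΛd : ∀ t, VectorCalculus.IsDivFree (Λ t) := fun t => hψ'.isDivFree_heatAdjointField hψd ν t
  have hΛsupp : ∀ t, t ∉ Icc a' b' → Λ t = 0 := fun t ht =>
    heatAdjointField_eq_zero_of_time_support hsupp ν ht
  -- the duality identity at time `t ∈ (0, T)` tested with `Λ(t)`
  have key : ∀ t ∈ Ioo 0 T, (∫ x, ⟪u t x, Λ t x⟫) =
      (∫ x, ⟪u₀ x, heatTest ν (Λ t) t x⟫) +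
        (∫ τ in (0 : ℝ)..t, ∫ x, ⟪u τ x, convect (u τ) (heatTest ν (Λ t) (t - τ)) x⟫) +
        ∫ τ in (0 : ℝ)..t, ∫ x, ⟪f τ x, heatTest ν (Λ t) (t - τ) x⟫ :=
    fun t ht => h.2 t ⟨ht.1.le, ht.2⟩ (Λ t) (hΛ.isTestFunctionOn_slice t) (hΛd t)
  -- (D) the datum term
  have hD : ∫ t in Ioo 0 T, ∫ x, ⟪u₀ x, heatTest ν (Λ t) t x⟫ = -∫ x, ⟪u₀ x, ψ 0 x⟫ := by
    rw [setIntegral_congr_set Ioo_ae_eq_Ioc]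
    exact integral_Ioc_integral_inner_heatTest_heatAdjointField_eq_neg hν hq1 hu₀ hψ' hsupp hT.le
      hb'T.le
  -- (N) the nonlinear term
  obtain ⟨hN, hNint⟩ := hu.integral_Ioo_intervalIntegral_integral_inner_convect_heatTest_eq hν hq
    hmeas' hΛ hΛsupp hb'T.le
  -- (F) the force term
  obtain ⟨hF, hFint⟩ := integral_Ioo_intervalIntegral_integral_inner_force_heatTest_eq hν hf' hΛ
    hΛsupp hb'T.le
  -- `𝒰[Λ] = -ψ` and `D𝒰[Λ] = -Dψ` (backward heat equation)
  have hU : ∀ τ x, heatDuhamelBack ν Λ τ x = -ψ τ x := fun τ x =>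
    hψ'.heatDuhamelBack_heatAdjointField hν τ x
  have hDU : ∀ τ x, fderiv ℝ (heatDuhamelBack ν Λ τ) x = -fderiv ℝ (ψ τ) x := fun τ x => by
    have h : heatDuhamelBack ν Λ τ = -(ψ τ) := funext fun y => hU τ y
    rw [h, fderiv_neg]
  -- integrability in `t` of the slice pairings on `(0, T)`
  have hPp := hu.integrable_prod_inner_test measure_Ioo_lt_top.ne hq1 hmeas' hΛ
  have hQp := hu.integrable_prod_inner_convect_test measure_Ioo_lt_top.ne hq hmeas' hψ'
  have hRp := integrable_prod_inner_force_test hf' hψ'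
  have hP : Integrable (fun t => ∫ x, ⟪u t x, Λ t x⟫) (volume.restrict (Ioo 0 T)) :=
    hPp.integral_prod_left
  have hQ : Integrable (fun t => ∫ x, ⟪u t x, fderiv ℝ (ψ t) x (u t x)⟫)
      (volume.restrict (Ioo 0 T)) := hQp.integral_prod_left
  have hR : Integrable (fun t => ∫ x, ⟪f t x, ψ t x⟫) (volume.restrict (Ioo 0 T)) :=
    hRp.integral_prod_left
  have hDint : Integrable (fun t => ∫ x, ⟪u₀ x, heatTest ν (Λ t) t x⟫) (volume.restrict (Ioo 0 T)) := by
    refine ((hP.sub hNint).sub hFint).congr ?_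
    refine (ae_restrict_iff' measurableSet_Ioo).2 (Eventually.of_forall fun t ht => ?_)
    simp only [Pi.sub_apply]
    rw [key t ht]
    ring
  -- (1) `∫ ⟨u, Λ⟩ dt = -⟨u₀, ψ(0)⟩ - ∫∫ ⟨u, (u·∇)ψ⟩ - ∫∫ ⟨f, ψ⟩`
  have h1 : ∫ t in Ioo 0 T, ∫ x, ⟪u t x, Λ t x⟫ =
      -(∫ x, ⟪u₀ x, ψ 0 x⟫) - (∫ t in Ioo 0 T, ∫ x, ⟪u t x, fderiv ℝ (ψ t) x (u t x)⟫) -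
        ∫ t in Ioo 0 T, ∫ x, ⟪f t x, ψ t x⟫ := by
    have hDN : Integrable (fun t => (∫ x, ⟪u₀ x, heatTest ν (Λ t) t x⟫) +
        ∫ τ in (0 : ℝ)..t, ∫ x, ⟪u τ x, convect (u τ) (heatTest ν (Λ t) (t - τ)) x⟫)
        (volume.restrict (Ioo 0 T)) := hDint.add hNint
    rw [setIntegral_congr_fun measurableSet_Ioo key, integral_add hDN hFint,
      integral_add hDint hNint, hD, hN, hF]
    have eN : ∫ τ in Ioo 0 T, ∫ x, ⟪u τ x, fderiv ℝ (heatDuhamelBack ν Λ τ) x (u τ x)⟫ =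
        -∫ τ in Ioo 0 T, ∫ x, ⟪u τ x, fderiv ℝ (ψ τ) x (u τ x)⟫ := by
      rw [← integral_neg]
      refine setIntegral_congr_fun measurableSet_Ioo fun τ _ => ?_
      rw [← integral_neg]
      refine integral_congr_ae (Eventually.of_forall fun x => ?_)
      show ⟪u τ x, fderiv ℝ (heatDuhamelBack ν Λ τ) x (u τ x)⟫ = -⟪u τ x, fderiv ℝ (ψ τ) x (u τ x)⟫
      rw [hDU]
      simp
    have eF : ∫ τ in Ioo 0 T, ∫ x, ⟪f τ x, heatDuhamelBack ν Λ τ x⟫ =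
        -∫ τ in Ioo 0 T, ∫ x, ⟪f τ x, ψ τ x⟫ := by
      rw [← integral_neg]
      refine setIntegral_congr_fun measurableSet_Ioo fun τ _ => ?_
      rw [← integral_neg]
      refine integral_congr_ae (Eventually.of_forall fun x => ?_)
      show ⟪f τ x, heatDuhamelBack ν Λ τ x⟫ = -⟪f τ x, ψ τ x⟫
      rw [hU, inner_neg_right]
    rw [eN, eF]
    ring
  -- (2) the weak integrand splits slicewise, for a.e. `t`
  have e2 : ∀ᵐ t ∂(volume.restrict (Ioo 0 T)),
      (∫ x, (⟪u t x, timeDeriv ψ t x⟫ + ⟪u t x, convect (u t) (ψ t) x⟫ +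
        ν * ⟪u t x, Δ (ψ t) x⟫ + ⟪f t x, ψ t x⟫)) =
        (∫ x, ⟪u t x, Λ t x⟫) + (∫ x, ⟪u t x, fderiv ℝ (ψ t) x (u t x)⟫) +
          ∫ x, ⟪f t x, ψ t x⟫ := by
    filter_upwards [hPp.prod_right_ae, hQp.prod_right_ae, hRp.prod_right_ae] with t iP iQ iR
    have iPQ : Integrable (fun x => ⟪u t x, Λ t x⟫ + ⟪u t x, fderiv ℝ (ψ t) x (u t x)⟫) volume :=
      iP.add iQ
    rw [← integral_add iP iQ, ← integral_add iPQ iR]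
    refine integral_congr_ae (Eventually.of_forall fun x => ?_)
    simp only [hΛ_def, inner_add_right, real_inner_smul_right, convect_apply]
    ring
  have hPQ : Integrable (fun t => (∫ x, ⟪u t x, Λ t x⟫) + ∫ x, ⟪u t x, fderiv ℝ (ψ t) x (u t x)⟫)
      (volume.restrict (Ioo 0 T)) := hP.add hQ
  rw [integral_congr_ae e2, integral_add hPQ hR, integral_add hP hQ, h1]
  ring

end Main

end Literature.Analysis.FluidPDE
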